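import Summits.NavierStokesRegularity.NavierStokesRegularity.Theorems.CertifiedBlowupCertifiedBlowupAxisymBlowupSwirlPersists
import HarnessLib

/-!
# The swirl order parameter of a witness of the crux `CertifiedBlowupAxisymBlowup`
# (= `SwirlThreshold.AxisymBlowup`): `M(t) = sup_x |Γ(t, x)|` is finite, positive and strictly
# decreasing on the whole of `[0, T)`

Theorems file landed `--supports stmt-NavierStokesRegularity-0727`, line `compact-amplification`
(continuation lead c2; bet route `SwirlThreshold`). Route `SwirlThreshold` organises the
axisymmetric-with-swirl blow-up problem by the order parameter `M_u(t) = sup_x |r u_θ(t, x)|` of a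
witness `(ν, T, u, p)` (its threshold `Re_c = ν⁻¹ inf M_u(t)`, the support (T1)
`SwirlSupStrictDecrease`, stmt-2004). This file makes `M_u` a kernel-checked object for every
witness, in the `sSup` form used by the proof of `SwirlSupStrictDecrease_proof`:

* `exists_abs_swirl_mul_le_of_lerayHopf_classical` — decay `|Γ(τ, x)| (1 + |x|²) ≤ D` on every
  closed sub-slab `[0, t₁]`, `t₁ < T` (bounded velocity and axisymmetric slices by
  `regular_of_classical_lerayHopf`, then the decaying barrier `abs_swirl_mul_le_of_classical`);
* `bddAbove_abs_swirl_of_lerayHopf_classical` — so `M_u(t) < ∞` for `t ∈ [0, T)`;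
* `sSup_abs_swirl_pos_of_isMaximalSmoothSolution` — `M_u(t) > 0` for `t ∈ [0, T)` (the swirl of a
  witness vanishes identically at no time, `exists_swirl_ne_zero_of_isMaximalSmoothSolution`);
* `exists_sSup_abs_swirl_eq_of_isMaximalSmoothSolution` — the supremum is attained;
* `strictAntiOn_sSup_abs_swirl_of_isMaximalSmoothSolution` — `M_u` is STRICTLY decreasing on
  `[0, T)` (`swirlSup_strictAnti_of_isMaximalSmoothSolution` + attainment);
* `swirlSup_pos_strictAntiOn_of_isMaximalSmoothSolution` — the registered conjunction.

No new definitions, no named-fact hypotheses, no `sorry`.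

## References

* Z. Lei, Q. S. Zhang, Pacific J. Math. 289 (2017), (1.4). [LeiZhang2017]
* G. Koch, N. Nadirashvili, G. Seregin, V. Šverák, Acta Math. 203 (2009), Lemma 2.1. [KNSS2009]
* D. Chae, J. Lee, Math. Z. 239 (2002). [ChaeLee2002]
-/

-- the summit and its single problem share the name (D-0017 nested layout)
set_option linter.dupNamespace false

noncomputable section

open MeasureTheory Set Function Filter Topology Metric
open scoped ENNReal NNReal

namespace Summit.NavierStokesRegularity.NavierStokesRegularity.Theorems.CertifiedBlowupAxisymBlowup.CompactAmplification

open Literature.Analysis.FluidPDE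
open Summit.NavierStokesRegularity.NavierStokesRegularity.Theorems.SwirlSupStrictDecrease

section Witness

variable {ν T : ℝ} {u : ℝ → EuclideanSpace ℝ (Fin 3) → EuclideanSpace ℝ (Fin 3)}
  {p : ℝ → EuclideanSpace ℝ (Fin 3) → ℝ}

/-- **Decay of the swirl on closed sub-slabs.** Along a classical Leray–Hopf solution on `[0, T)`
from a rapidly decaying axisymmetric datum, for `0 < t₁ < T` there is `D` with
`|Γ(τ, x)| (1 + |x|²) ≤ D` for all `τ ∈ [0, t₁]` and all `x` (the datum's decay constant propagated
by the decaying barrier `abs_swirl_mul_le_of_classical`, with the velocity bound and the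
axisymmetric slices of `regular_of_classical_lerayHopf`). [cite: LeiZhang2017, (1.4)] -/
theorem exists_abs_swirl_mul_le_of_lerayHopf_classical (hν : 0 < ν)
    (hcl : IsClassicalNSSolutionOn (Ico 0 T) ν 0 u p) (hLH : IsLerayHopfOn T ν 0 (u 0) u)
    (hdec : HasRapidSpatialDecay (u 0)) (haxi : IsAxisymmetric (u 0)) {t₁ : ℝ} (ht₁0 : 0 < t₁)
    (ht₁T : t₁ < T) :
    ∃ D : ℝ, ∀ τ ∈ Icc 0 t₁, ∀ x, |swirl (u τ) x| * (1 + ‖x‖ ^ 2) ≤ D := by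
  obtain ⟨hclt, ⟨V, -, hV⟩, haxit⟩ := regular_of_classical_lerayHopf hν hcl hLH hdec haxi ht₁0 ht₁T
  obtain ⟨C, hC⟩ := hdec 0 3
  have hM₀ : ∀ x, |swirl (u 0) x| * (1 + ‖x‖ ^ 2) ≤ 2 * C := by
    intro x
    have h1 := hC x
    rw [norm_iteratedFDeriv_zero] at h1
    have h2 : |swirl (u 0) x| ≤ 2 * ‖x‖ * ‖u 0 x‖ := abs_swirl_le_norm_mul (u 0) x
    have h3 : ‖x‖ * (1 + ‖x‖ ^ 2) ≤ (1 + ‖x‖) ^ 3 := by nlinarith [norm_nonneg x, sq_nonneg ‖x‖]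
    have h4 : 0 ≤ ‖u 0 x‖ := norm_nonneg _
    calc |swirl (u 0) x| * (1 + ‖x‖ ^ 2) ≤ 2 * ‖x‖ * ‖u 0 x‖ * (1 + ‖x‖ ^ 2) :=
          mul_le_mul_of_nonneg_right h2 (by positivity)
      _ = 2 * (‖x‖ * (1 + ‖x‖ ^ 2)) * ‖u 0 x‖ := by ring
      _ ≤ 2 * (1 + ‖x‖) ^ 3 * ‖u 0 x‖ := by gcongr
      _ = 2 * ((1 + ‖x‖) ^ 3 * ‖u 0 x‖) := by ring
      _ ≤ 2 * C := by linarith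
  have hC0 : 0 ≤ 2 * C := by
    have h1 : 0 ≤ |swirl (u 0) 0| * (1 + ‖(0 : EuclideanSpace ℝ (Fin 3))‖ ^ 2) := by positivity
    exact h1.trans (hM₀ 0)
  have hdecay := abs_swirl_mul_le_of_classical hν ht₁0 hclt haxit hV hM₀
  refine ⟨2 * C * Real.exp ((6 * ν + V + 1) * t₁), fun τ hτ x => (hdecay τ hτ x).trans ?_⟩
  refine mul_le_mul_of_nonneg_left (Real.exp_le_exp.2 ?_) hC0
  have hVpos : 0 ≤ 6 * ν + V + 1 := by
    have := (norm_nonneg _).trans (hV 0 ⟨le_rfl, ht₁0.le⟩ 0)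
    linarith
  exact mul_le_mul_of_nonneg_left hτ.2 hVpos

/-- **`M_u(t) < ∞`**: the swirl of every slice `u t`, `t ∈ [0, T)`, is bounded. [folklore] -/
theorem bddAbove_abs_swirl_of_lerayHopf_classical (hν : 0 < ν) (hT : 0 < T)
    (hcl : IsClassicalNSSolutionOn (Ico 0 T) ν 0 u p) (hLH : IsLerayHopfOn T ν 0 (u 0) u)
    (hdec : HasRapidSpatialDecay (u 0)) (haxi : IsAxisymmetric (u 0)) :
    ∀ t ∈ Ico 0 T, BddAbove (Set.range fun x => |swirl (u t) x|) := by
  intro t ht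
  set t₁ : ℝ := (t + T) / 2 with ht₁_def
  have ht₁0 : 0 < t₁ := by rw [ht₁_def]; linarith [ht.1, hT]
  have ht₁T : t₁ < T := by rw [ht₁_def]; linarith [ht.2]
  have htt₁ : t ≤ t₁ := by rw [ht₁_def]; linarith [ht.2]
  obtain ⟨D, hD⟩ := exists_abs_swirl_mul_le_of_lerayHopf_classical hν hcl hLH hdec haxi ht₁0 ht₁T
  refine ⟨D, ?_⟩
  rintro _ ⟨x, rfl⟩
  have h := hD t ⟨ht.1, htt₁⟩ x
  exact le_trans (le_mul_of_one_le_right (abs_nonneg _) (by nlinarith [sq_nonneg ‖x‖])) h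

/-- **`M_u(t) > 0`**: for a witness of the crux the swirl supremum is positive at every time before
the lifespan (the swirl vanishes identically at no such time). [folklore] -/
theorem sSup_abs_swirl_pos_of_isMaximalSmoothSolution (hν : 0 < ν) (hT : 0 < T)
    (hmax : IsMaximalSmoothSolution ν 0 u p T) (hLH : IsLerayHopfOn T ν 0 (u 0) u)
    (hdec : HasRapidSpatialDecay (u 0)) (haxi : IsAxisymmetric (u 0)) :
    ∀ t ∈ Ico 0 T, 0 < sSup (Set.range fun x => |swirl (u t) x|) := by
  intro t ht
  obtain ⟨x, hx⟩ := exists_swirl_ne_zero_of_isMaximalSmoothSolution hν hT hmax hLH hdec haxi t ht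
  exact lt_of_lt_of_le (abs_pos.2 hx)
    (le_csSup (bddAbove_abs_swirl_of_lerayHopf_classical hν hT hmax.1 hLH hdec haxi t ht) ⟨x, rfl⟩)

/-- **The swirl supremum of a witness is attained** at every time before the lifespan (a continuous
nonnegative function decaying at infinity which is positive somewhere has a maximum point,
`exists_forall_le_of_decay`). [folklore] -/
theorem exists_sSup_abs_swirl_eq_of_isMaximalSmoothSolution (hν : 0 < ν) (hT : 0 < T)
    (hmax : IsMaximalSmoothSolution ν 0 u p T) (hLH : IsLerayHopfOn T ν 0 (u 0) u)
    (hdec : HasRapidSpatialDecay (u 0)) (haxi : IsAxisymmetric (u 0)) :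
    ∀ t ∈ Ico 0 T, ∃ xs, (∀ x, |swirl (u t) x| ≤ |swirl (u t) xs|) ∧
      sSup (Set.range fun x => |swirl (u t) x|) = |swirl (u t) xs| := by
  intro t ht
  set t₁ : ℝ := (t + T) / 2 with ht₁_def
  have ht₁0 : 0 < t₁ := by rw [ht₁_def]; linarith [ht.1, hT]
  have ht₁T : t₁ < T := by rw [ht₁_def]; linarith [ht.2]
  have htt₁ : t ≤ t₁ := by rw [ht₁_def]; linarith [ht.2]
  obtain ⟨D, hD⟩ := exists_abs_swirl_mul_le_of_lerayHopf_classical hν hmax.1 hLH hdec haxi ht₁0 ht₁T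
  obtain ⟨x₁, hx₁⟩ := exists_swirl_ne_zero_of_isMaximalSmoothSolution hν hT hmax hLH hdec haxi t ht
  have hcont : Continuous fun x => |swirl (u t) x| :=
    (contDiff_swirl (hmax.1.contDiff_velocity ht)).continuous.abs
  obtain ⟨xs, hxs⟩ := exists_forall_le_of_decay hcont (hD t ⟨ht.1, htt₁⟩) (abs_pos.2 hx₁)
  refine ⟨xs, hxs, le_antisymm ?_ ?_⟩
  · exact csSup_le (range_nonempty _) (by rintro _ ⟨x, rfl⟩; exact hxs x)
  · exact le_csSup (bddAbove_abs_swirl_of_lerayHopf_classical hν hT hmax.1 hLH hdec haxi t ht) ⟨xs, rfl⟩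

/-- **`M_u` is strictly decreasing on `[0, T)`** for every witness of the crux: for
`0 ≤ s < t < T`, `sup_x |Γ(t, x)| < sup_x |Γ(s, x)|` (strict decrease below the value at one point,
`swirlSup_strictAnti_of_isMaximalSmoothSolution`, and attainment of the supremum at time `t`).
[cite: LeiZhang2017, (1.4)] -/
theorem strictAntiOn_sSup_abs_swirl_of_isMaximalSmoothSolution (hν : 0 < ν) (hT : 0 < T)
    (hmax : IsMaximalSmoothSolution ν 0 u p T) (hLH : IsLerayHopfOn T ν 0 (u 0) u)
    (hdec : HasRapidSpatialDecay (u 0)) (haxi : IsAxisymmetric (u 0)) :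
    StrictAntiOn (fun t => sSup (Set.range fun x => |swirl (u t) x|)) (Ico 0 T) := by
  intro s hs t ht hst
  obtain ⟨y, hy⟩ := swirlSup_strictAnti_of_isMaximalSmoothSolution hν hT hmax hLH hdec haxi s t hs.1 hst ht.2
  obtain ⟨xs, -, hxs⟩ := exists_sSup_abs_swirl_eq_of_isMaximalSmoothSolution hν hT hmax hLH hdec haxi t ht
  show sSup (Set.range fun x => |swirl (u t) x|) < sSup (Set.range fun x => |swirl (u s) x|)
  rw [hxs]
  exact lt_of_lt_of_le (hy xs)
    (le_csSup (bddAbove_abs_swirl_of_lerayHopf_classical hν hT hmax.1 hLH hdec haxi s hs) ⟨y, rfl⟩)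

end Witness

/-- **The swirl order parameter of every witness of the crux** (registered stub of
stmt-NavierStokesRegularity-0727, route `SwirlThreshold`'s (T1) in order-parameter form): along a
maximal Leray–Hopf classical solution `(u, p)` of finite lifespan `T` from a rapidly decaying
axisymmetric datum, `M_u(t) = sup_x |x₀u₁ − x₁u₀| = sup_x |r u_θ(t, x)|` is finite and positive at
every `t ∈ [0, T)` and strictly decreasing on `[0, T)`. [cite: LeiZhang2017, (1.4)] -/
theorem swirlSup_pos_strictAntiOn_of_isMaximalSmoothSolution : ∀ {ν T : ℝ} {u : ℝ → EuclideanSpace ℝ (Fin 3) → EuclideanSpace ℝ (Fin 3)} {p : ℝ → EuclideanSpace ℝ (Fin 3) → ℝ}, 0 < ν → 0 < T → IsMaximalSmoothSolution ν 0 u p T → IsLerayHopfOn T ν 0 (u 0) u → HasRapidSpatialDecay (u 0) → IsAxisymmetric (u 0) → (∀ t ∈ Set.Ico 0 T, BddAbove (Set.range fun x => |swirl (u t) x|) ∧ 0 < sSup (Set.range fun x => |swirl (u t) x|)) ∧ StrictAntiOn (fun t => sSup (Set.range fun x => |swirl (u t) x|)) (Set.Ico 0 T) := by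
  intro ν T u p hν hT hmax hLH hdec haxi
  exact ⟨fun t ht => ⟨bddAbove_abs_swirl_of_lerayHopf_classical hν hT hmax.1 hLH hdec haxi t ht,
      sSup_abs_swirl_pos_of_isMaximalSmoothSolution hν hT hmax hLH hdec haxi t ht⟩,
    strictAntiOn_sSup_abs_swirl_of_isMaximalSmoothSolution hν hT hmax hLH hdec haxi⟩

end Summit.NavierStokesRegularity.NavierStokesRegularity.Theorems.CertifiedBlowupAxisymBlowup.CompactAmplification

end
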